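import Summits.BirchSwinnertonDyer.Rank1Residual.Additive.SpecialJSupersingular
import Literature.NumberTheory.EllipticCurves.ComplexMultiplicationDeuring1728Proofs
import Literature.NumberTheory.EllipticCurves.OpenImageMazurNumericsProofs
import HarnessLib

/-!
# The trace law for `j = 1728`: `a = 2u`, `p = u² + v²`, and anomalous reduction only at `p = 5`

HONEST FRAMING (cell `b2b-bsdres`, run/shared/lean/b2b/bsd-rank1-residual/, verbatim in every
file): the goal of the cell is to DELETE the COMBINATION-SHAPED residual classes of the
Birch–Swinnerton-Dyer formula for ALL analytic-rank `≤ 1` elliptic curves over `ℚ` — "full BSD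
formula for every rank `≤ 1` curve in class `C`" assembled STRICTLY from published theorems — so
that the rank-`≤ 1` remainder becomes exactly the CONSTRUCTION-SHAPED classes, which are TYPED
(missing-input `Prop`s), NOT attempted. This is not "finishing BSD". Sub-cell `additive-p2`
(X3♯(G-ord) / X4♯(G-ord)), generation 35: research route; no claim beyond the stated classes;
theorems only, no definition, no named fact, nothing booked, no label moved.

## What is proved (NUMERICS ⇒ STRUCTURE ⇒ THEOREM)

Gen 11's anomalous census over the minimal (G)-field (`census/anom/ANOM-CENSUS.md`, 1280 pairs)
records on its 265 defect-`4` rows (Kodaira `III`, `III*`; reduction `j̃ = 1728`; `233` rows at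
`p = 5`, `32` at `p ∈ {13, 17, 29, 37, 53}`) that `a_𝔭 = 2u` with `p = u² + v²` (LAW 3 of gen 34's
`ANOMALOUS-J0-READING.md`, there only checked), that at `p = 5` the trace lies in `{±2, ±4}`, and
that the `70` anomalous defect-`4` rows are exactly the rows with `#Ẽ(𝔽_5) = 10`. All three follow
from a theorem of Gauss (Ireland–Rosen, GTM 84, Ch. 18 §4 Thm. 5: for `p ≡ 1 (mod 4)`, `p ∤ D`,
`#{y² = x³ − Dx}(𝔽_p) = p + 1 − \overline{χ_π(D)}π − χ_π(D)π̄`, `π ≡ 1 (2 + 2i)` primary, `ππ̄ = p`),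
whose Jacobi-sum proof the tree holds as `IrelandRosen1990_card_points_one_mod_four_holds`
(`CongruentNumberCurveJacobiSums`) and runs for GLOBAL `j = 1728` curves in
`ComplexMultiplicationDeuring1728Proofs`. This file runs it for an ARBITRARY elliptic curve with
`j = 1728` over a field with `p` elements — the reductions `Ẽ_w` of the (G)-cell are not reductions
of global `j = 1728` curves — the companion of gen 34's `SpecialJTraceFormZero` (`j = 0`,
`a² + 3m² = 4q`):

* `SpecialJ.natCard_point_map_ringEquiv` — transport: for a ring isomorphism `e : R ≃+* S`,
  `#(W.map e)(S) = #W(R)` (coordinates moved by `e`; Mathlib's `Affine.map_nonsingular`);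
* `SpecialJ.exists_norm_eq_and_trace_eq_two_mul_re_of_a₆_eq_zero` — `E : y² = x³ + a₄x` elliptic over
  `ZMod p`, `p ≡ 1 (mod 4)`: `p + 1 − #E(𝔽_p) = 2 Re π` for some `π ∈ ℤ[i]` with `N(π) = p`;
  `…_of_j_eq` — the same for every elliptic `E/𝔽_p` with `j(E) = 1728` (short model, `a₆ = 0`);
* **`SpecialJ.exists_trace_eq_two_mul_and_sq_add_sq_of_j_eq`** — over ANY field `k` with a prime
  number `p ≡ 1 (mod 4)` of elements: `j(E) = 1728` ⟹ **`p + 1 − #E(k) = 2u` and `u² + v² = p`**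
  for some `u, v ∈ ℤ`; equivalently **`(p + 1 − #E(k))² + 4v² = 4p`**
  (`…exists_trace_sq_add_four_mul_sq_of_j_eq`: Hasse's defect `4p − a²` is an even square); and
  `SpecialJ.exists_trace_eq_two_mul_of_j_eq` — `a = 2u` with `u ≠ 0`, `u² < p` (a prime is not a
  square, the tree's `Mazur1978.sq_ne_prime`).

The sibling files of gen 35 continue: `SpecialJAnomalousFive.lean` (part 2: at `#k = 5` the trace lies
in `{±2, ±4}`, and a `j = 1728` curve over `𝔽_p`, `p ≥ 5`, is anomalous only at `p = 5` with
`#E(𝔽_5) = 10`) and `GordTraceFormFour.lean` (part 3: the degree-one good places of the (G)-cell at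
defect `4`, and the uniform norm-form law of the cell off defect `2`).

References: K. Ireland, M. Rosen, GTM 84 (2nd ed. 1990), Ch. 18 §4 Thm. 5 and its proof; C. F. Gauss,
*Theoria residuorum biquadraticorum* I (1828) §§15–23; D. A. Cox, *Primes of the form x² + ny²*
(2nd ed.) Thm. 14.16, (14.17); B. Mazur, Invent. Math. 18 (1972) §5 (anomalous primes);
J. H. Silverman, *AEC* V.1.1, Ex. V.4.5; R. Greenberg, LNM 1716 (1999) Thm. 4.1. Tree:
`CongruentNumberCurveJacobiSums`, `ComplexMultiplicationDeuring1728Proofs` (x10 / CM lane and the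
congruent-number lane, consumed by name), `SpecialJOrdinary/Supersingular` (gens 3, 9).
-/

noncomputable section

open scoped Classical

open WeierstrassCurve Literature.NumberTheory.EllipticCurves

namespace Summit.BirchSwinnertonDyer.Rank1Residual.Additive

namespace SpecialJ

/-! ### Point transport along a ring isomorphism -/

section Transport

variable {R S : Type*} [CommRing R] [CommRing S] (W : WeierstrassCurve R) (e : R ≃+* S)

/-- **Transport of points along a ring isomorphism.** For `e : R ≃+* S` and a Weierstrass curve
`W/R`, the curve `W.map e` over `S` has the same number of rational points: `(x, y) ↦ (e x, e y)` is a
bijection on nonsingular affine points (Mathlib `Affine.map_nonsingular`), `𝒪 ↦ 𝒪`. Used to move an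
elliptic curve over an arbitrary field with `p` elements to `ZMod p` (`ZMod.ringEquivOfPrime`).
[folklore] -/
theorem natCard_point_map_ringEquiv :
    Nat.card (W.map (e : R →+* S)).toAffine.Point = Nat.card W.toAffine.Point := by
  -- equality of `some`-points from equality of coordinates (proof irrelevance)
  have hsome : ∀ {a b a' b' : S} (q : (W.map (e : R →+* S)).toAffine.Nonsingular a b)
      (q' : (W.map (e : R →+* S)).toAffine.Nonsingular a' b'),
      a = a' → b = b' → Affine.Point.some a b q = Affine.Point.some a' b' q' := by
    intro a b a' b' q q' ha hb
    subst ha hb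
    rfl
  symm
  refine Nat.card_eq_of_bijective
    (fun P ↦ match P with
      | .zero => .zero
      | .some x y h => .some ((e : R →+* S) x) ((e : R →+* S) y)
          ((Affine.map_nonsingular (W := W.toAffine) (f := (e : R →+* S)) e.injective x y).mpr h))
    ⟨?_, ?_⟩
  · rintro (_ | ⟨x, y, h⟩) (_ | ⟨x', y', h'⟩) hPQ
    · rfl
    · simp at hPQ
    · simp at hPQ
    · simp only [Affine.Point.some.injEq] at hPQ
      obtain ⟨hx, hy⟩ := hPQ
      have hx' : x = x' := e.injective (by simpa only [RingEquiv.coe_toRingHom] using hx)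
      have hy' : y = y' := e.injective (by simpa only [RingEquiv.coe_toRingHom] using hy)
      subst hx' hy'
      rfl
  · rintro (_ | ⟨x', y', h'⟩)
    · exact ⟨.zero, rfl⟩
    · refine ⟨.some (e.symm x') (e.symm y') ((Affine.map_nonsingular (W := W.toAffine)
        (f := (e : R →+* S)) e.injective (e.symm x') (e.symm y')).mp ?_), ?_⟩
      · simpa only [RingEquiv.coe_toRingHom, RingEquiv.apply_symm_apply] using h'
      · exact hsome _ h' (by simp) (by simp)

end Transport

/-! ### The norm form of `ℤ[i]` -/

/-- The norm form of `ℤ[i]`: `N(u + vi) = u² + v²` (Mathlib `Zsqrtd.norm_def` at `d = −1`). [folklore] -/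
theorem sq_add_sq_eq_of_norm_eq (π : GaussianInt) {n : ℤ} (h : π.norm = n) :
    π.re ^ 2 + π.im ^ 2 = n := by
  rw [Zsqrtd.norm_def] at h
  linear_combination h

/-! ### `y² = x³ + a₄x` over `𝔽_p`, `p ≡ 1 (mod 4)`: the trace is `2 Re π`, `N(π) = p` -/

section ZModShort

variable {p : ℕ} [hp : Fact p.Prime] (E : WeierstrassCurve (ZMod p)) [E.IsShortNF] [E.IsElliptic]

open Literature.NumberTheory.QuadraticFields.GaussianPrimary GaussianQuartic in
/-- **Gauss / Ireland–Rosen for an arbitrary `y² = x³ + a₄x` over `𝔽_p`, `p ≡ 1 (mod 4)`.** For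
`E : y² = x³ + a₄x` elliptic (`a₆ = 0`, so `a₄ ≠ 0`) over `ZMod p` with `p ≡ 1 (mod 4)`: there is
`π ∈ ℤ[i]` with `N(π) = p` and `p + 1 − #E(𝔽_p) = 2 Re π`. Proof: `E = E_D : y² = x³ − Dx` with
`D = −a₄`, `p ∤ D`; `p = a² + b²` (Fermat), `π₀` the primary associate of `a + bi` (the tree's
`GaussianPrimary.primary`), `χ_{π₀}(D) = i^k` (the tree's quartic character `GaussianQuartic.chi`);
Ireland–Rosen 18.5 (`IrelandRosen1990_card_points_one_mod_four_holds`) gives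
`#E_D(𝔽_p) = p + 1 − 2 Re(ī^k π₀)`; take `π = ī^k π₀`. The assembly is the one of
`Deuring1941_frobeniusTrace_eq_add_conj_of_j_eq` (global `j = 1728` curves), run for a curve that
need not be a reduction of a global one. [cite: IrelandRosen1990, Ch. 18 §4, Theorem 5 (PDF p. 301)] -/
theorem exists_norm_eq_and_trace_eq_two_mul_re_of_a₆_eq_zero (hp1 : p % 4 = 1) (h6 : E.a₆ = 0) :
    ∃ π : GaussianInt, π.norm = p ∧
      ((p : ℤ) + 1 - Nat.card E.toAffine.Point) = 2 * π.re := by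
  have hpp : p.Prime := hp.out
  -- `E = E_D`, `D = -a₄`, `p ∤ D`
  have ha₄ : E.a₄ ≠ 0 := by
    intro h0
    have hΔ : E.Δ = 0 := by rw [E.Δ_of_isShortNF, h0, h6]; ring
    exact E.isUnit_Δ.ne_zero hΔ
  set D : ℤ := -(((E.a₄).val : ℕ) : ℤ) with hD
  have hDp : (D : ZMod p) = -E.a₄ := by
    rw [hD]; push_cast; rw [ZMod.natCast_zmod_val]
  have hE : E = ⟨0, 0, 0, -(D : ZMod p), 0⟩ := by
    rw [hDp, neg_neg]
    ext
    · exact E.a₁_of_isShortNF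
    · exact E.a₂_of_isShortNF
    · exact E.a₃_of_isShortNF
    · rfl
    · exact h6
  have hpD : ¬ (p : ℤ) ∣ D := by
    rw [← ZMod.intCast_zmod_eq_zero_iff_dvd, hDp, neg_eq_zero]
    exact ha₄
  -- a primary `π₀` of norm `p`
  obtain ⟨a, b, hab⟩ := Nat.Prime.sq_add_sq (p := p) (by omega)
  set π₁ : GaussianInt := ⟨a, b⟩ with hπ₁
  have hπ₁p : π₁.norm = p := by
    rw [Zsqrtd.norm_def, hπ₁]; push_cast; rw [← hab]; push_cast; ring
  have hpar : (π₁.re + π₁.im) % 2 = 1 := by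
    rw [← norm_emod_two, hπ₁p]; exact_mod_cast (show (p : ℤ) % 2 = 1 by omega)
  set π₀ : GaussianInt := primary π₁ with hπ₀
  have hπ₀P : IsPrimary π₀ := isPrimary_primary hpar
  have hπ₀p : π₀.norm = p := by rw [hπ₀, norm_primary hpar, hπ₁p]
  have hπ₀1 : (⟨2, 2⟩ : GaussianInt) ∣ π₀ - 1 := (isPrimary_iff_dvd π₀).mp hπ₀P
  -- `χ_{π₀}(D) = i^k`
  have hD0 : ((D : ℤ) : ZMod p) ≠ 0 := by rwa [Ne, ZMod.intCast_zmod_eq_zero_iff_dvd]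
  obtain ⟨k, hk⟩ : ∃ k : ℕ, chi hp1 hπ₀p (D : ZMod p) = ⟨0, 1⟩ ^ k := by
    rcases eq_of_isUnit (isUnit_chi hp1 hπ₀p hD0) with h | h | h | h
    · exact ⟨0, by rw [h, pow_zero]⟩
    · exact ⟨2, by rw [h]; decide⟩
    · exact ⟨1, by rw [h, pow_one]⟩
    · exact ⟨3, by rw [h]; decide⟩
  have hkdvd : π₀ ∣ (D : GaussianInt) ^ ((p - 1) / 4) - ⟨0, 1⟩ ^ k := by
    apply dvd_of_red_eq_zero hπ₀p
    have hred := (chi_eq_iff hp1 hπ₀p hD0 (isUnit_I.pow k)).mp hk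
    rw [map_sub, map_pow, map_intCast, show (p - 1) / 4 = p / 4 by omega, ← hred, sub_self]
  -- Ireland–Rosen 18.5
  have hN := IrelandRosen1990_card_points_one_mod_four_holds hp1 hpD hπ₀p hπ₀1 hkdvd
  set π : GaussianInt := star ((⟨0, 1⟩ : GaussianInt) ^ k) * π₀ with hπ
  have hu : IsUnit (star ((⟨0, 1⟩ : GaussianInt) ^ k)) := (isUnit_I.pow k).star
  refine ⟨π, ?_, ?_⟩
  · rw [hπ, Zsqrtd.norm_mul, (Zsqrtd.norm_eq_one_iff' (by norm_num) _).mpr hu, one_mul, hπ₀p]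
  · have hcard : Nat.card E.toAffine.Point =
        Nat.card (⟨0, 0, 0, -(D : ZMod p), 0⟩ : WeierstrassCurve (ZMod p)).toAffine.Point :=
      congrArg (fun X : WeierstrassCurve (ZMod p) ↦ Nat.card X.toAffine.Point) hE
    rw [hcard]
    linear_combination (-1 : ℤ) * hN

end ZModShort

/-! ### General equations with `j = 1728` over `𝔽_p`, `p ≡ 1 (mod 4)` -/

section ZModGeneral

variable {p : ℕ} [hp : Fact p.Prime] (E : WeierstrassCurve (ZMod p)) [E.IsElliptic]

/-- **The trace law for `j = 1728` over `ZMod p`, `p ≡ 1 (mod 4)`**: `p + 1 − #E(𝔽_p) = 2 Re π` with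
`π ∈ ℤ[i]`, `N(π) = p`. Reduction to the short model `y² = x³ + a₄x` (`E.toShortNF • E`, same point
count by the tree's `VariableChange.pointEquiv`; `j = 1728` forces `a₆ = 0`,
`a₆_eq_zero_of_j_eq`). [cite: IrelandRosen1990, Ch. 18 §4, Theorem 5] -/
theorem exists_norm_eq_and_trace_eq_two_mul_re_of_j_eq (hp1 : p % 4 = 1) (hj : E.j = 1728) :
    ∃ π : GaussianInt, π.norm = p ∧
      ((p : ℤ) + 1 - Nat.card E.toAffine.Point) = 2 * π.re := by
  have hp5 : 5 ≤ p := GaussianQuartic.five_le hp1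
  obtain ⟨h2, h3⟩ := ringChar_ne_two_and_ne_three (F := ZMod p) (ZMod.ringChar_zmod_n p) hp5
  obtain ⟨h2', h3'⟩ := two_ne_zero_and_three_ne_zero h2 h3
  haveI : Invertible (2 : ZMod p) := invertibleOfNonzero h2'
  haveI : Invertible (3 : ZMod p) := invertibleOfNonzero h3'
  haveI : (E.toShortNF • E).IsShortNF := E.toShortNF_spec
  have hjS : (E.toShortNF • E).j = 1728 := by rw [variableChange_j, hj]
  have h6 : (E.toShortNF • E).a₆ = 0 := a₆_eq_zero_of_j_eq (E.toShortNF • E) h2' h3' hjS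
  rw [Nat.card_congr (VariableChange.pointEquiv E E.toShortNF).toEquiv]
  exact exists_norm_eq_and_trace_eq_two_mul_re_of_a₆_eq_zero (E.toShortNF • E) hp1 h6

end ZModGeneral

/-! ### Any field with `p` elements: `a = 2u`, `p = u² + v²` -/

section PrimeField

variable {k : Type*} [Field k] [Finite k] (E : WeierstrassCurve k) [E.IsElliptic] {p : ℕ}

/-- **THE TRACE LAW FOR `j = 1728`.** For an elliptic curve `E` over a field `k` with a prime number
`p ≡ 1 (mod 4)` of elements and `j(E) = 1728`: **`p + 1 − #E(k) = 2u` and `u² + v² = p` for some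
`u, v ∈ ℤ`** — the trace is the trace of an element `u + vi ∈ ℤ[i]` of norm `p`. (`k ≅ ZMod p` by
`ZMod.ringEquivOfPrime`; points transported by `natCard_point_map_ringEquiv`; `j` is preserved.)
Gauss; Ireland–Rosen Ch. 18 §4 Thm. 5; cf. Cox, *Primes of the form x² + ny²*, Thm. 14.16.
[cite: IrelandRosen1990, Ch. 18 §4, Theorem 5] -/
theorem exists_trace_eq_two_mul_and_sq_add_sq_of_j_eq (hp : p.Prime) (hp1 : p % 4 = 1)
    (hcard : Nat.card k = p) (hj : E.j = 1728) :
    ∃ u v : ℤ, ((p : ℤ) + 1 - Nat.card E.toAffine.Point) = 2 * u ∧ u ^ 2 + v ^ 2 = p := by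
  haveI := Fintype.ofFinite k
  haveI : Fact p.Prime := ⟨hp⟩
  have hcard' : Fintype.card k = p := by rw [← Nat.card_eq_fintype_card, hcard]
  set e : k ≃+* ZMod p := (ZMod.ringEquivOfPrime k hp hcard').symm with he
  have hj' : (E.map (e : k →+* ZMod p)).j = 1728 := by
    rw [map_j, RingEquiv.coe_toRingHom, hj, map_ofNat]
  obtain ⟨π, hπ, ht⟩ :=
    exists_norm_eq_and_trace_eq_two_mul_re_of_j_eq (E.map (e : k →+* ZMod p)) hp1 hj'
  refine ⟨π.re, π.im, ?_, sq_add_sq_eq_of_norm_eq π hπ⟩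
  rw [← natCard_point_map_ringEquiv E e]
  exact ht

/-- **The trace law for `j = 1728`, norm form**: over a field with a prime number `p ≡ 1 (mod 4)` of
elements, `j(E) = 1728` ⟹ **`(p + 1 − #E(k))² + 4v² = 4p`** for some `v ∈ ℤ` (Hasse's defect
`4p − a²` is the square of an even integer; companion of the `j = 0` law `a² + 3m² = 4q`).
[cite: IrelandRosen1990, Ch. 18 §4, Theorem 5] -/
theorem exists_trace_sq_add_four_mul_sq_of_j_eq (hp : p.Prime) (hp1 : p % 4 = 1)
    (hcard : Nat.card k = p) (hj : E.j = 1728) :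
    ∃ v : ℤ, ((p : ℤ) + 1 - Nat.card E.toAffine.Point) ^ 2 + 4 * v ^ 2 = 4 * p := by
  obtain ⟨u, v, ha, huv⟩ := exists_trace_eq_two_mul_and_sq_add_sq_of_j_eq E hp hp1 hcard hj
  exact ⟨v, by rw [ha]; linear_combination (4 : ℤ) * huv⟩

/-- **The trace is even and nonzero, and `(a/2)² < p`**: `j(E) = 1728`, `#k = p ≡ 1 (mod 4)` ⟹
`p + 1 − #E(k) = 2u` with `u ≠ 0` and `u² < p` (so `E` is ordinary with `a ≠ 0`; gen 3's
`not_dvd_trace_of_j_eq_of_card_eq` gave `p ∤ a`). [cite: IrelandRosen1990, Ch. 18 §4, Theorem 5] -/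
theorem exists_trace_eq_two_mul_of_j_eq (hp : p.Prime) (hp1 : p % 4 = 1) (hcard : Nat.card k = p)
    (hj : E.j = 1728) :
    ∃ u : ℤ, ((p : ℤ) + 1 - Nat.card E.toAffine.Point) = 2 * u ∧ u ≠ 0 ∧ u ^ 2 < p := by
  obtain ⟨u, v, ha, huv⟩ := exists_trace_eq_two_mul_and_sq_add_sq_of_j_eq E hp hp1 hcard hj
  have hv : v ≠ 0 := by
    rintro rfl
    exact Mazur1978.sq_ne_prime hp u (by linear_combination huv)
  have hu : u ≠ 0 := by
    rintro rfl
    exact Mazur1978.sq_ne_prime hp v (by linear_combination huv)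
  refine ⟨u, ha, hu, ?_⟩
  have hv2 : 0 < v ^ 2 := by positivity
  linarith

end PrimeField

end SpecialJ

end Summit.BirchSwinnertonDyer.Rank1Residual.Additive

end
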